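import Summits.NavierStokesRegularity.NavierStokesRegularity.Theorems.TypeICertificateLadderStrainRateWeightedVorticity
import Summits.NavierStokesRegularity.NavierStokesRegularity.Theorems.TypeICertificateLadderRungReynoldsOneTaoCover
import Literature.Analysis.FluidPDE.NSVorticityBKMHolds
import Literature.Analysis.FluidPDE.PutativeSelfSimilarEulerProofs
import HarnessLib

/-!
# Route TypeICertificateLadder — the explicit STRAIN-rate constant `1` at a singular time
  (C32 of cell pub-ns-dss; sibling of the Leray-rate rung `X_1`, helper of crux
  stmt-NavierStokesRegularity-2882)

**C32.** Let `(u, p)` be a classical solution of the unforced Navier–Stokes system (`ν > 0`) on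
`ℝ³ × [0, T)` in the Beale–Kato–Majda class (all `L²` Sobolev norms bounded on every `[0, T'']`,
`T'' < T`) which cannot be continued in that class past `T`. Then for every `θ < 1` the largest
eigenvalue of the strain exceeds `θ/(T − t)` somewhere, frequently as `t ↑ T`:
`∃ᶠ t → T⁻, ∃ x ξ, θ‖ξ‖² < (T − t)⟪∇u(t,x) ξ, ξ⟫` — i.e.
`limsup_{t↑T} (T − t) · sup_x λ_max(S(x,t)) ≥ 1` (note `⟪∇u ξ, ξ⟫ = ⟪S ξ, ξ⟫`). Elementary, NO
Liouville theorem: under the strain bound the weighted vorticity estimate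
`weightedVorticity_le_of_strain_bound` (`TypeICertificateLadderStrainRateWeightedVorticity.lean`)
gives `‖ω(t)‖_∞ ≤ √M (T − t)^{−θ}`, integrable for `θ < 1`, and the Beale–Kato–Majda criterion
(tree: `beale_kato_majda_holds`) continues the solution. Printed relatives: Chae, J. Funct. Anal.
2010, Thm 1.1 (Euler, `‖∇v‖_∞`); Chae–Kang–Lee 2009, Rmk 1.

* `strainRate_frequently_gt_of_not_hasSobolevExtensionPast` (C32, BKM class),
  `strainRate_frequently_gt_of_not_hasSmoothExtensionPast`,
  `typeICertificateLadder_strainRate_frequently_gt` (Fefferman / Leray–Hopf class of the ladder,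
  via the landed `stub_taoCover`), `strainRate_exists_gt_of_isMaximalSmoothSolution`.

HONEST FRAMING: statements about a HYPOTHETICAL singular time; no such solution is asserted to
exist; `1` is the threshold of this elementary argument and nothing is said at or above it;
nothing here bears on the regularity question itself. Lands `--supports stmt-NavierStokesRegularity-2882`.
-/

noncomputable section

namespace Summit.NavierStokesRegularity.NavierStokesRegularity.Theorems

set_option linter.dupNamespace false

open MeasureTheory Set Filter Topology Function
open scoped RealInnerProductSpace Laplacian ContDiff
open Literature.Analysis Literature.Analysis.FluidPDE

/-! ### C32: the strain rate exceeds `θ/(T − t)`, `θ < 1`, frequently at a singular time -/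

/-- **C32 (BKM class).** Let `(u, p)` be a classical solution of unforced Navier–Stokes (`ν > 0`) on
`ℝ³ × [0,T)`, `T > 0`, with all `L²` Sobolev norms bounded on every `[0,T'']`, `T'' < T`, which
cannot be continued in this class past `T` (`¬ HasSobolevExtensionPast`). Then for every `θ < 1`,
frequently as `t ↑ T`, some point `x` and direction `ξ` have `θ‖ξ‖² < (T − t)⟪∇u(t,x) ξ, ξ⟫`
(`= (T − t)⟪S(x,t)ξ, ξ⟫`): `limsup_{t↑T} (T − t) sup_x λ_max(S) ≥ 1`. Otherwise
`weightedVorticity_le_of_strain_bound` gives `‖ω(t)‖_∞ ≤ √M (T − t)^{−θ'}` (`θ' = max θ ½`),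
integrable on `(0,T)`, and the Beale–Kato–Majda criterion (`beale_kato_majda_holds`) continues the
solution. [this file; Beale–Kato–Majda 1984 Thm 1; cf. Chae 2010 Thm 1.1 (Euler)] -/
theorem strainRate_frequently_gt_of_not_hasSobolevExtensionPast {ν T : ℝ} (hν : 0 < ν)
    (hT : 0 < T) {u : ℝ → EuclideanSpace ℝ (Fin 3) → EuclideanSpace ℝ (Fin 3)}
    {p : ℝ → EuclideanSpace ℝ (Fin 3) → ℝ}
    (hsol : IsClassicalNSSolutionOn (Ico 0 T) ν 0 u p)
    (hreg : ∀ T'' < T, HasBoundedSobolevNormsOn (Icc 0 T'') u)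
    (hmax : ¬ HasSobolevExtensionPast ν u T) {θ : ℝ} (hθ : θ < 1) :
    ∃ᶠ t in 𝓝[<] T, ∃ x ξ : EuclideanSpace ℝ (Fin 3),
      θ * ‖ξ‖ ^ 2 < (T - t) * ⟪fderiv ℝ (u t) x ξ, ξ⟫ := by
  by_contra h
  simp only [Filter.not_frequently, not_exists, not_lt] at h
  -- the strain bound with `θ' = max θ ½ ∈ (0, 1)` on a window `(t₀, T)`
  set θ' : ℝ := max θ (1 / 2) with hθ'def
  have hθ'0 : 0 < θ' := lt_of_lt_of_le one_half_pos (le_max_right _ _)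
  have hθ'1 : θ' < 1 := max_lt hθ (by norm_num)
  have h' : ∀ᶠ t in 𝓝[<] T, ∀ x ξ : EuclideanSpace ℝ (Fin 3),
      (T - t) * ⟪fderiv ℝ (u t) x ξ, ξ⟫ ≤ θ' * ‖ξ‖ ^ 2 :=
    h.mono fun t ht x ξ => (ht x ξ).trans (mul_le_mul_of_nonneg_right (le_max_left _ _) (sq_nonneg _))
  obtain ⟨T₀, hT₀T, hT₀⟩ := mem_nhdsLT_iff_exists_Ioo_subset.1 h'
  set t₀ : ℝ := max T₀ (T / 2) with ht₀def
  have ht₀T : t₀ < T := max_lt hT₀T (by linarith)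
  have ht₀0 : 0 < t₀ := lt_of_lt_of_le (by linarith) (le_max_right _ _)
  have hstrain : ∀ t ∈ Ioo t₀ T, ∀ x ξ : EuclideanSpace ℝ (Fin 3),
      (T - t) * ⟪fderiv ℝ (u t) x ξ, ξ⟫ ≤ θ' * ‖ξ‖ ^ 2 := fun t ht =>
    hT₀ ⟨lt_of_le_of_lt (le_max_left _ _) ht.1, ht.2⟩
  obtain ⟨M, hM⟩ := weightedVorticity_le_of_strain_bound hν hθ'0.le ht₀0 ht₀T hsol hreg hstrain
  have hM0 : 0 ≤ M := le_trans (mul_nonneg (Real.rpow_nonneg (sub_pos.2 ht₀T).le _) (sq_nonneg _))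
    (hM t₀ ⟨le_rfl, ht₀T⟩ 0)
  -- the vorticity bound on `[0, t₀]`
  have hsmooth : ∀ t ∈ Ico 0 T, ContDiff ℝ ∞ (u t) := fun t ht => hsol.contDiff_velocity ht
  obtain ⟨B₁, hB₁0, hB₁⟩ := exists_forall_norm_iteratedFDeriv_le_bkmClass
    (fun t ht => hsmooth t ⟨ht.1, ht.2.trans_lt ht₀T⟩) (hreg t₀ ht₀T) 1
  set κ₀ : ℝ := ‖(curlCLM : (EuclideanSpace ℝ (Fin 3) →L[ℝ] EuclideanSpace ℝ (Fin 3)) →L[ℝ]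
    EuclideanSpace ℝ (Fin 3))‖ with hκ₀
  have hκ₀0 : 0 ≤ κ₀ := by rw [hκ₀]; positivity
  have hcurl_le : ∀ (f : EuclideanSpace ℝ (Fin 3) → EuclideanSpace ℝ (Fin 3)) (x),
      ‖curl f x‖ ≤ κ₀ * ‖iteratedFDeriv ℝ 1 f x‖ := fun f x => by
    rw [curl_eq_curlCLM, ← norm_iteratedFDeriv_fderiv, norm_iteratedFDeriv_zero]
    exact ContinuousLinearMap.le_opNorm _ _
  -- the pointwise bound `‖ω(t,x)‖ ≤ Kc (T − t)^{−θ'}` on `(0,T) × ℝ³`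
  set Kc : ℝ := max (κ₀ * B₁ * T ^ θ') (Real.sqrt M) with hKc
  have hbound : ∀ t ∈ Ioo 0 T, ∀ x, ‖curl (u t) x‖ ≤ Kc * (T - t) ^ (-θ') := by
    intro t ht x
    have hTt : 0 < T - t := sub_pos.2 ht.2
    have hpow : 0 < (T - t) ^ θ' := Real.rpow_pos_of_pos hTt _
    rw [Real.rpow_neg hTt.le, ← div_eq_mul_inv, le_div_iff₀ hpow]
    rcases lt_or_ge t t₀ with hlt | hge
    · -- before `t₀`: Sobolev sup bound, `(T − t)^θ' ≤ T^θ'`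
      have h1 : ‖curl (u t) x‖ ≤ κ₀ * B₁ :=
        (hcurl_le _ x).trans (mul_le_mul_of_nonneg_left (hB₁ t ⟨ht.1.le, hlt.le⟩ x) hκ₀0)
      have h2 : (T - t) ^ θ' ≤ T ^ θ' :=
        Real.rpow_le_rpow hTt.le (by linarith [ht.1]) hθ'0.le
      calc ‖curl (u t) x‖ * (T - t) ^ θ'
          ≤ κ₀ * B₁ * T ^ θ' := mul_le_mul h1 h2 hpow.le (by positivity)
        _ ≤ Kc := le_max_left _ _
    · -- after `t₀`: the weighted bound `(T − t)^{2θ'}‖ω‖² ≤ M`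
      have h1 := hM t ⟨hge, ht.2⟩ x
      have e2 : ((T - t) ^ θ') ^ 2 = (T - t) ^ (2 * θ') := by
        rw [← Real.rpow_two, ← Real.rpow_mul hTt.le]
        congr 1
        ring
      have e : (‖curl (u t) x‖ * (T - t) ^ θ') ^ 2 = (T - t) ^ (2 * θ') * ‖curl (u t) x‖ ^ 2 := by
        rw [mul_pow, e2, mul_comm]
      have h2 : (‖curl (u t) x‖ * (T - t) ^ θ') ^ 2 ≤ M := by rw [e]; exact h1
      have h3 : ‖curl (u t) x‖ * (T - t) ^ θ' ≤ Real.sqrt M := by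
        rw [← Real.sqrt_sq (by positivity : 0 ≤ ‖curl (u t) x‖ * (T - t) ^ θ')]
        exact Real.sqrt_le_sqrt h2
      exact h3.trans (le_max_right _ _)
  -- hence `∫₀ᵀ ‖ω(t)‖_{L^∞} dt < ∞`, and BKM continues the solution past `T`
  have hfin : (∫⁻ t in Ioo 0 T, ⨆ x, ‖curl (u t) x‖ₑ) < ⊤ := by
    refine lt_of_le_of_lt (setLIntegral_mono' measurableSet_Ioo fun t ht => ?_)
      (CIV2026.lintegral_Ioo_rpow_neg_lt_top Kc hθ'1)
    refine iSup_le fun x => ?_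
    rw [← ofReal_norm]
    exact ENNReal.ofReal_le_ofReal (hbound t ht x)
  exact hmax ((beale_kato_majda_holds hν.le hT hsol hreg).2 hfin)

/-- **C32, smooth-extension phrasing.** Under the hypotheses of
`strainRate_frequently_gt_of_not_hasSobolevExtensionPast` but with "no SMOOTH extension past `T`"
(`¬ HasSmoothExtensionPast ν 0 u T`, which a Sobolev-class continuation would provide,
`HasSobolevExtensionPast.hasSmoothExtensionPast`). [this file] -/
theorem strainRate_frequently_gt_of_not_hasSmoothExtensionPast {ν T : ℝ} (hν : 0 < ν)
    (hT : 0 < T) {u : ℝ → EuclideanSpace ℝ (Fin 3) → EuclideanSpace ℝ (Fin 3)}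
    {p : ℝ → EuclideanSpace ℝ (Fin 3) → ℝ}
    (hsol : IsClassicalNSSolutionOn (Ico 0 T) ν 0 u p)
    (hreg : ∀ T'' < T, HasBoundedSobolevNormsOn (Icc 0 T'') u)
    (hsing : ¬ HasSmoothExtensionPast ν 0 u T) {θ : ℝ} (hθ : θ < 1) :
    ∃ᶠ t in 𝓝[<] T, ∃ x ξ : EuclideanSpace ℝ (Fin 3),
      θ * ‖ξ‖ ^ 2 < (T - t) * ⟪fderiv ℝ (u t) x ξ, ξ⟫ :=
  strainRate_frequently_gt_of_not_hasSobolevExtensionPast hν hT hsol hreg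
    (fun h => hsing h.hasSmoothExtensionPast) hθ

/-- **C32 in the Fefferman / Leray–Hopf class of the ladder.** A classical solution of the unforced
Navier–Stokes system on `ℝ³ × [0,T)` (`ν, T > 0`), Leray–Hopf on `[0,T]` from its rapidly decaying
datum, with no smooth extension past `T`, satisfies for every `θ < 1`:
`θ‖ξ‖² < (T − t)⟪∇u(t,x) ξ, ξ⟫` for some `x, ξ`, frequently as `t ↑ T`. The BKM-class hypothesis is
supplied by the landed `stub_taoCover` (Tao 2013 Thm 5.4: such solutions have all Sobolev norms
bounded on every `[0,T']`, `T' < T`). [this file] -/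
theorem typeICertificateLadder_strainRate_frequently_gt {ν T : ℝ} (hν : 0 < ν) (hT : 0 < T)
    {u : ℝ → EuclideanSpace ℝ (Fin 3) → EuclideanSpace ℝ (Fin 3)}
    {p : ℝ → EuclideanSpace ℝ (Fin 3) → ℝ}
    (hsol : IsClassicalNSSolutionOn (Ico 0 T) ν 0 u p) (hLH : IsLerayHopfOn T ν 0 (u 0) u)
    (hdec : HasRapidSpatialDecay (u 0)) (hsing : ¬ HasSmoothExtensionPast ν 0 u T)
    {θ : ℝ} (hθ : θ < 1) :
    ∃ᶠ t in 𝓝[<] T, ∃ x ξ : EuclideanSpace ℝ (Fin 3),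
      θ * ‖ξ‖ ^ 2 < (T - t) * ⟪fderiv ℝ (u t) x ξ, ξ⟫ := by
  have hreg : ∀ T'' < T, HasBoundedSobolevNormsOn (Icc 0 T'') u := by
    intro T'' hT''
    set T' : ℝ := max T'' (T / 2) with hT'
    have hT'm : T' ∈ Ioo 0 T := ⟨lt_of_lt_of_le (by linarith) (le_max_right _ _), max_lt hT'' (by linarith)⟩
    obtain ⟨q, -, hB, -, -⟩ := RungReynoldsOne.stub_taoCover hν hT hsol hLH hdec hT'm
    exact hB.mono (Icc_subset_Icc_right (le_max_left _ _))
  exact strainRate_frequently_gt_of_not_hasSmoothExtensionPast hν hT hsol hreg hsing hθ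

/-- **C32 for a maximal smooth solution, filter-free form.** For `IsMaximalSmoothSolution ν 0 u p T`
(classical on `[0,T)`, no smooth extension past `T`), Leray–Hopf from a rapidly decaying datum: for
every `θ < 1` and every `t₁ < T` there are `t ∈ (t₁, T)`, `x` and `ξ` with
`θ‖ξ‖² < (T − t)⟪∇u(t,x) ξ, ξ⟫`. [this file] -/
theorem strainRate_exists_gt_of_isMaximalSmoothSolution {ν T : ℝ} (hν : 0 < ν) (hT : 0 < T)
    {u : ℝ → EuclideanSpace ℝ (Fin 3) → EuclideanSpace ℝ (Fin 3)}
    {p : ℝ → EuclideanSpace ℝ (Fin 3) → ℝ}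
    (hmax : IsMaximalSmoothSolution ν 0 u p T) (hLH : IsLerayHopfOn T ν 0 (u 0) u)
    (hdec : HasRapidSpatialDecay (u 0)) {θ : ℝ} (hθ : θ < 1) :
    ∀ t₁ < T, ∃ t, t₁ < t ∧ t < T ∧ ∃ x ξ : EuclideanSpace ℝ (Fin 3),
      θ * ‖ξ‖ ^ 2 < (T - t) * ⟪fderiv ℝ (u t) x ξ, ξ⟫ := by
  intro t₁ ht₁
  have hfr := typeICertificateLadder_strainRate_frequently_gt hν hT hmax.1 hLH hdec hmax.2 hθ
  have hev : ∀ᶠ t in 𝓝[<] T, t₁ < t ∧ t < T := by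
    have h1 : ∀ᶠ t in 𝓝[<] T, t ∈ Ioo t₁ T := Ioo_mem_nhdsLT ht₁
    exact h1.mono fun t ht => ⟨ht.1, ht.2⟩
  obtain ⟨t, ⟨hx, ht⟩⟩ := (hfr.and_eventually hev).exists
  exact ⟨t, ht.1, ht.2, hx⟩

end Summit.NavierStokesRegularity.NavierStokesRegularity.Theorems

end
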